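import Literature.Topology.FourManifolds.GenericFoldChart
import Literature.Topology.FourManifolds.IndefiniteFoldChartTransport
import HarnessLib

/-!
# Indefinite fold points recognised in rank-one coordinates

Topic `Literature/Topology/FourManifolds`.  The working criterion for indefinite fold points
of a map `F : ℝ⁴ → ℝ²` (Baykur–Saeki 2017, §2.1; Lekili 2009, §3): bring `F` to rank-one form
`(q₀, f̃ q)` in some smooth charts `φ` (centred at `p`) and `ψ` — always possible when
`dF_p ≠ 0` (`RankOneNormalForm.lean`) — and check that the fibre gradient of `f̃` (in the
variables `q₁, q₂, q₃`) vanishes at `0` with nondegenerate INDEFINITE fibre Hessian.  Then `p` is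
an indefinite fold point of `F` (`HasIndefiniteFoldChart F p`, the chart condition of
`IsSimplifiedBrokenLefschetzFibration.fold`).  This file PROVES the criterion from the real
normal form `hasIndefiniteFoldChart_fibredMap` (`GenericFoldChart.lean`), after

* `HasIndefiniteFoldChart.congr_of_eventuallyEq` — the chart condition is LOCAL at the point;
* `HasIndefiniteFoldChart.of_localRepresentative` — and INVARIANT under smooth local changes of
  coordinates in source and target (the model-space case of
  `exists_foldChart_of_hasIndefiniteFoldChart`, `IndefiniteFoldChartTransport.lean`);
* `unfibre : ℝ × ℝ³ → ℝ⁴`, the inverse of `q ↦ (q₀, fibrePart q)`;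
* `hasIndefiniteFoldChart_of_rankOneChart` — **the criterion**.

No named fact is introduced.

## References

* R. İ. Baykur, O. Saeki, *Simplifying indefinite fibrations on 4-manifolds*, arXiv:1705.11169
  (Trans. AMS 376, 2023), §2.1. [BaykurSaeki2017]
* Y. Lekili, *Wrinkled fibrations on near-symplectic manifolds*, Geom. Topol. 13 (2009), §3.
  [Lekili2009]
-/

noncomputable section

-- Instance search through the tower `E →L[ℝ] E →L[ℝ] ℝ` needs one more level of pending depth,
-- as in `MorseLemma.lean` and `HadamardLemma.lean`.
set_option maxSynthPendingDepth 2

open Set Function Filter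
open scoped Manifold Topology ContDiff

namespace Literature.Topology.FourManifolds

/-- Local notation: `𝔼 n` is the model Euclidean space `EuclideanSpace ℝ (Fin n)`. -/
local notation "𝔼 " n:arg => EuclideanSpace ℝ (Fin n)

/-! ### Locality and invariance of the chart condition -/

/-- **The chart condition is local**: if `F₁ = F₂` near `y` then an indefinite fold chart of
`F₁` at `y` restricts to one of `F₂`. [folklore] -/
theorem HasIndefiniteFoldChart.congr_of_eventuallyEq {F₁ F₂ : 𝔼 4 → 𝔼 2} {y : 𝔼 4}
    (h : HasIndefiniteFoldChart F₁ y) (heq : F₁ =ᶠ[𝓝 y] F₂) : HasIndefiniteFoldChart F₂ y := by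
  obtain ⟨φ, ψ, hy, hy0, hmaps, hφ, hφs, hψ, hψs, hid⟩ := h
  obtain ⟨S, hSsub, hSo, hyS⟩ : ∃ S ⊆ {q | F₁ q = F₂ q}, IsOpen S ∧ y ∈ S :=
    _root_.mem_nhds_iff.1 heq
  have hsrc : (φ.restrOpen S hSo).source = φ.source ∩ S :=
    OpenPartialHomeomorph.restrOpen_source φ S hSo
  have htgt : (φ.restrOpen S hSo).target ⊆ φ.target := by
    intro z hz
    have h1 : (φ.restrOpen S hSo).symm z ∈ (φ.restrOpen S hSo).source :=
      (φ.restrOpen S hSo).map_target hz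
    have h2 : (φ.restrOpen S hSo) ((φ.restrOpen S hSo).symm z) = z :=
      (φ.restrOpen S hSo).right_inv hz
    rw [hsrc] at h1
    have h3 : φ (φ.symm z) = z := h2
    rw [← h3]
    exact φ.map_source h1.1
  refine ⟨φ.restrOpen S hSo, ψ, ?_, hy0, ?_, ?_, hφs.mono htgt, hψ, hψs, ?_⟩
  · rw [hsrc]
    exact ⟨hy, hyS⟩
  · intro q hq
    rw [hsrc] at hq
    rw [← show F₁ q = F₂ q from hSsub hq.2]
    exact hmaps hq.1
  · rw [hsrc]
    exact hφ.mono inter_subset_left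
  · intro q hq
    rw [hsrc] at hq
    rw [← show F₁ q = F₂ q from hSsub hq.2]
    exact hid q hq.1

/-- **The chart condition is invariant under smooth local coordinate changes**: if in local
diffeomorphisms `Φ₀` of `ℝ⁴` at `p` and `Ψ₀` of `ℝ²` (`F (Φ₀.source) ⊆ Ψ₀.source`) the local
representative `Ψ₀ ∘ F ∘ Φ₀⁻¹` has an indefinite fold chart at `Φ₀ p`, then `F` has one at `p`
(compose the charts; the model-space case of `exists_foldChart_of_hasIndefiniteFoldChart`).
[folklore] -/
theorem HasIndefiniteFoldChart.of_localRepresentative {F : 𝔼 4 → 𝔼 2} {p : 𝔼 4}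
    {Φ₀ : OpenPartialHomeomorph (𝔼 4) (𝔼 4)} {Ψ₀ : OpenPartialHomeomorph (𝔼 2) (𝔼 2)}
    (hΦ₀ : ContDiffOn ℝ ∞ Φ₀ Φ₀.source) (hΦ₀s : ContDiffOn ℝ ∞ Φ₀.symm Φ₀.target)
    (hΨ₀ : ContDiffOn ℝ ∞ Ψ₀ Ψ₀.source) (hΨ₀s : ContDiffOn ℝ ∞ Ψ₀.symm Ψ₀.target)
    (hmaps : MapsTo F Φ₀.source Ψ₀.source) (hp : p ∈ Φ₀.source)
    (h : HasIndefiniteFoldChart (Ψ₀ ∘ F ∘ Φ₀.symm) (Φ₀ p)) : HasIndefiniteFoldChart F p := by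
  obtain ⟨φ, ψ, hpφ, hp0, hmaps', hφ, hφs, hψ, hψs, hid⟩ :=
    exists_foldChart_of_hasIndefiniteFoldChart (contMDiffOn_iff_contDiffOn.2 hΦ₀)
      (contMDiffOn_iff_contDiffOn.2 hΦ₀s) (contMDiffOn_iff_contDiffOn.2 hΨ₀)
      (contMDiffOn_iff_contDiffOn.2 hΨ₀s) hmaps hp h
  exact ⟨φ, ψ, hpφ, hp0, hmaps', contMDiffOn_iff_contDiffOn.1 hφ, contMDiffOn_iff_contDiffOn.1 hφs,
    contMDiffOn_iff_contDiffOn.1 hψ, contMDiffOn_iff_contDiffOn.1 hψs, hid⟩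

/-! ### `ℝ × ℝ³ ≅ ℝ⁴` -/

/-- The map `(t, w) ↦ (t, w₀, w₁, w₂)`, inverse to `q ↦ (q₀, fibrePart q)`, as a continuous
linear map. [folklore] -/
def unfibre : (ℝ × 𝔼 3) →L[ℝ] 𝔼 4 :=
  (ContinuousLinearMap.fst ℝ ℝ (𝔼 3)).smulRight (EuclideanSpace.single (0 : Fin 4) (1 : ℝ)) +
    ∑ i : Fin 3, ((EuclideanSpace.proj i : 𝔼 3 →L[ℝ] ℝ).comp
      (ContinuousLinearMap.snd ℝ ℝ (𝔼 3))).smulRight (EuclideanSpace.single i.succ (1 : ℝ))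

/-- `(unfibre (t, w)) 0 = t`. [folklore] -/
@[simp] theorem unfibre_apply_zero (p : ℝ × 𝔼 3) : unfibre p 0 = p.1 := by
  simp [unfibre, Fin.succ_ne_zero]

/-- `(unfibre (t, w)) (i+1) = wᵢ`. [folklore] -/
@[simp] theorem unfibre_apply_succ (p : ℝ × 𝔼 3) (i : Fin 3) : unfibre p i.succ = p.2 i := by
  simp [unfibre, Pi.single_apply, Fin.succ_inj, mul_ite]

/-- `fibrePart (unfibre (t, w)) = w`. [folklore] -/
@[simp] theorem fibrePart_unfibre (p : ℝ × 𝔼 3) : fibrePart (unfibre p) = p.2 := by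
  ext i
  rw [fibrePart_apply, unfibre_apply_succ]

/-- `unfibre (q₀, fibrePart q) = q`. [folklore] -/
@[simp] theorem unfibre_fibrePart (q : 𝔼 4) : unfibre (q 0, fibrePart q) = q := by
  ext i
  refine Fin.cases ?_ (fun j => ?_) i
  · simp
  · rw [unfibre_apply_succ, fibrePart_apply]

/-! ### The criterion -/

/-- **Indefinite fold points in rank-one coordinates.**  Let `φ` be a local diffeomorphism of
`ℝ⁴` at `p` with `φ p = 0`, `ψ` one of `ℝ²`, `F (φ.source) ⊆ ψ.source`, and `f̃ : ℝ⁴ → ℝ`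
`C^∞` on `φ.target` with `ψ (F q) = ((φ q)₀, f̃ (φ q))` on `φ.source` (rank-one form, e.g. from
`exists_rankOne_charts`).  If the fibre gradient of `g̃ (t, w) = f̃ (t, w)` vanishes at `0` and
its fibre Hessian there is nondegenerate and indefinite, then `p` is an indefinite fold point
of `F` (`HasIndefiniteFoldChart F p`): Baykur–Saeki's real normal form of an indefinite fold.
[cite: BaykurSaeki2017, §2.1] -/
theorem hasIndefiniteFoldChart_of_rankOneChart {F : 𝔼 4 → 𝔼 2} {p : 𝔼 4}
    {φ : OpenPartialHomeomorph (𝔼 4) (𝔼 4)} {ψ : OpenPartialHomeomorph (𝔼 2) (𝔼 2)}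
    {f : 𝔼 4 → ℝ} (hpφ : p ∈ φ.source) (hp0 : φ p = 0) (hmaps : MapsTo F φ.source ψ.source)
    (hφ : ContDiffOn ℝ ∞ φ φ.source) (hφs : ContDiffOn ℝ ∞ φ.symm φ.target)
    (hψ : ContDiffOn ℝ ∞ ψ ψ.source) (hψs : ContDiffOn ℝ ∞ ψ.symm ψ.target)
    (hf : ContDiffOn ℝ ∞ f φ.target)
    (hid : ∀ q ∈ φ.source, ψ (F q) 0 = φ q 0 ∧ ψ (F q) 1 = f (φ q))
    (hcrit : fibreGrad (f ∘ unfibre) (0, 0) = 0)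
    (hH : ∀ a : 𝔼 3, (∀ b, fibreHessian (f ∘ unfibre) (0, 0) a b = 0) → a = 0)
    (hneg : ∃ a : 𝔼 3, fibreHessian (f ∘ unfibre) (0, 0) a a < 0)
    (hpos : ∃ b : 𝔼 3, 0 < fibreHessian (f ∘ unfibre) (0, 0) b b) :
    HasIndefiniteFoldChart F p := by
  have h0t : (0 : 𝔼 4) ∈ φ.target := hp0 ▸ φ.map_source hpφ
  -- cut `f` off outside `φ.target`
  obtain ⟨χ, hχ, hχt, hχ1⟩ :=
    Literature.Analysis.Calculus.exists_contDiff_bump_nhds φ.open_target h0t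
  set fc : 𝔼 4 → ℝ := fun y => χ y * f y with hfc
  have hfcs : ContDiff ℝ ∞ fc := by
    rw [contDiff_iff_contDiffAt]
    intro y
    by_cases hy : y ∈ φ.target
    · exact hχ.contDiffAt.mul (hf.contDiffAt (φ.open_target.mem_nhds hy))
    · have hy' : y ∉ tsupport χ := fun h => hy (hχt h)
      have hev : fc =ᶠ[𝓝 y] fun _ => 0 := by
        filter_upwards [(isClosed_tsupport χ).isOpen_compl.mem_nhds hy'] with z hz
        show χ z * f z = 0
        rw [image_eq_zero_of_notMem_tsupport hz, zero_mul]
      exact (contDiffAt_const (c := (0 : ℝ))).congr_of_eventuallyEq hev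
  set g : ℝ × 𝔼 3 → ℝ := fc ∘ unfibre with hg
  have hgs : ContDiff ℝ ∞ g := hfcs.comp unfibre.contDiff
  -- near `(0, 0)` the cut-off family agrees with `f ∘ unfibre`
  have hev : g =ᶠ[𝓝 ((0 : ℝ), (0 : 𝔼 3))] (f ∘ unfibre) := by
    have hc : ContinuousAt unfibre ((0 : ℝ), (0 : 𝔼 3)) := unfibre.continuous.continuousAt
    have h00 : unfibre ((0 : ℝ), (0 : 𝔼 3)) = 0 := map_zero unfibre
    have h1' : ∀ᶠ y in 𝓝 (unfibre ((0 : ℝ), (0 : 𝔼 3))), χ y = 1 := by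
      rw [h00]
      exact hχ1
    have h1 : ∀ᶠ x in 𝓝 ((0 : ℝ), (0 : 𝔼 3)), χ (unfibre x) = 1 := hc.eventually h1'
    filter_upwards [h1] with x hx
    show χ (unfibre x) * f (unfibre x) = f (unfibre x)
    rw [hx, one_mul]
  have hcrit' : fibreGrad g (0, 0) = 0 := by
    have h : fibreGrad g (0, 0) = fibreGrad (f ∘ unfibre) (0, 0) := by
      ext i
      simp only [fibreGrad_apply]
      rw [hev.fderiv_eq]
    exact h.trans hcrit
  have hHess : fibreHessian g (0, 0) = fibreHessian (f ∘ unfibre) (0, 0) := by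
    ext a b
    simp only [fibreHessian_apply, hev.fderiv.fderiv_eq]
  -- the real normal form for the fibred map of `g` at `0`
  have hx0 : ((0 : 𝔼 4) 0, fibrePart (0 : 𝔼 4)) = ((0 : ℝ), (0 : 𝔼 3)) := by simp
  have hfold : HasIndefiniteFoldChart (fibredMap g) 0 := by
    refine hasIndefiniteFoldChart_fibredMap hgs ?_ ?_ ?_ ?_
    · rw [hx0, hcrit']
    · rw [hx0, hHess]
      exact hH
    · rw [hx0, hHess]
      exact hneg
    · rw [hx0, hHess]
      exact hpos
  -- the local representative equals the fibred map near `0`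
  have hrep : fibredMap g =ᶠ[𝓝 (φ p)] (ψ ∘ F ∘ φ.symm) := by
    rw [hp0]
    filter_upwards [φ.open_target.mem_nhds h0t, hχ1] with y hy hχy
    have hq : φ.symm y ∈ φ.source := φ.map_target hy
    obtain ⟨h0', h1'⟩ := hid (φ.symm y) hq
    rw [φ.right_inv hy] at h0' h1'
    ext i
    fin_cases i
    · show fibredMap g y 0 = ψ (F (φ.symm y)) 0
      rw [fibredMap_apply_zero, h0']
    · show fibredMap g y 1 = ψ (F (φ.symm y)) 1
      rw [fibredMap_apply_one, h1']
      show fc (unfibre (y 0, fibrePart y)) = f y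
      rw [unfibre_fibrePart]
      show χ y * f y = f y
      rw [hχy, one_mul]
  rw [hp0] at hrep
  have hfold' : HasIndefiniteFoldChart (ψ ∘ F ∘ φ.symm) (φ p) := by
    rw [hp0]
    exact hfold.congr_of_eventuallyEq hrep
  exact HasIndefiniteFoldChart.of_localRepresentative hφ hφs hψ hψs hmaps hpφ hfold'

end Literature.Topology.FourManifolds

end
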